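import Summits.CriticalPhenomena.PercolationContinuityZ3.Theorems.PercNearOneGluingAdditiveGluingAL5RestrictedLemma3
import Summits.CriticalPhenomena.PercolationContinuityZ3.Theorems.PercNearOneGluingAdditiveGluingAL5Peel
import HarnessLib

/-! # Crux `PercNearOneGluing.AdditiveGluing` (stmt-CriticalPhenomena-4576) — the RESTRICTED star-gluing Lemma 5

Support file (`--supports stmt-CriticalPhenomena-4576`; task png-dp-al5); no definitions, no named facts.
`μ_w = prodBernoulli w` on the bond configurations of the weighted complete graph `Fin n`.

* `knLemma3i_restricted_prod` — product form of the restricted Lemma 3(i) (`…AL5RestrictedLemma3.lean`), keeping the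
  factor `μ(N ∩ Q)` on the slack (needed when the conditioning event has vanishing probability in a sprinkling limit).
* `starGlue_lemma5_restricted` — the star-gluing form of Kozma–Nitzan's Lemma 5 (`starGlue_lemma5`) with hypothesis AND
  conclusion restricted to `M = {c ↮ X}` (the weak vertex `c` not joined to `X`): if `μ_w(M ∩ c↔b) ≤ μ_w(M ∩ v↔b)` for an
  endpoint `v` of the star `D` at `x`, then the same holds after gluing `D`.  Proof: sprinkling as in `starGlue_lemma5`
  (`ε` on `D`, the event "all of `D` open" is increasing in `C_v`, condition, `ε → 0`), with the restricted Lemma 3(i) on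
  `{c ↮ X ∪ {v}}` in place of Lemma 3(i); the limit is taken in the form `μ_{w_ε}(N) · [μ_glue(N ∩ c↔b) − μ_glue(N ∩ v↔b)] ≤ o(1)`.
[cite: KozmaNitzan2024, Lemma 5 (p. 13), Lemma 3(i) (pp. 6–7)] [cite: VandenbergHaggstromKahn2005, Thms. 1.3–1.5]
-/

namespace Summit.CriticalPhenomena.PercolationContinuityZ3.Theorems

open MeasureTheory Set
open Literature.Probability.LatticeModels (prodBernoulli)
open Literature.Probability.Percolation (BondConfig openConn openConnIn openGraph openEdgeCluster pinW localCylinder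
  DeterminedBy determinedBy_iff)

noncomputable section
open Classical

section AL5RestrictedLemma5

open Filter Topology Literature.Probability.LatticeModels Literature.Probability.Percolation

variable {n : ℕ}

/-- Product form of the restricted Lemma 3(i) (core case `v ∈ X`, `c ∉ X`): with `N = {c ↮ X}`,
`μ(N)·μ(N ∩ c↔b ∩ Q) ≤ μ(N)·μ(N ∩ v↔b ∩ Q) + d·μ(N ∩ Q)` whenever `μ(N ∩ c↔b) ≤ μ(N ∩ v↔b) + d`, `Q` increasing and
determined by `C_v`.  (Same chain as `knLemma3i_restricted_core`, keeping the factor `μ(N ∩ Q)` on the slack — needed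
when the conditioning event `Q` has vanishing probability in the sprinkling limit.)
[cite: KozmaNitzan2024, Lemma 3(i) (pp. 6–7)] [cite: VandenbergHaggstromKahn2005, Thms. 1.3–1.5] -/
theorem knLemma3i_restricted_prod (w : Sym2 (Fin n) → unitInterval) (c v b : Fin n) (X : Set (Fin n))
    (hvX : v ∈ X) (hcX : c ∉ X) (Q : Set (BondConfig (Fin n))) (d : ℝ)
    (hQ : ∀ ω ω', ω ∈ Q → openEdgeCluster ω v ⊆ openEdgeCluster ω' v → ω' ∈ Q)
    (hle : (prodBernoulli w).real ({ω : BondConfig (Fin n) | ∀ y ∈ X, ¬ (openGraph ω).Reachable c y} ∩ openConn c b) ≤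
      (prodBernoulli w).real ({ω : BondConfig (Fin n) | ∀ y ∈ X, ¬ (openGraph ω).Reachable c y} ∩ openConn v b) + d) :
    (prodBernoulli w).real {ω : BondConfig (Fin n) | ∀ y ∈ X, ¬ (openGraph ω).Reachable c y} *
        (prodBernoulli w).real ({ω : BondConfig (Fin n) | ∀ y ∈ X, ¬ (openGraph ω).Reachable c y} ∩ openConn c b ∩ Q) ≤
      (prodBernoulli w).real {ω : BondConfig (Fin n) | ∀ y ∈ X, ¬ (openGraph ω).Reachable c y} *
        (prodBernoulli w).real ({ω : BondConfig (Fin n) | ∀ y ∈ X, ¬ (openGraph ω).Reachable c y} ∩ openConn v b ∩ Q) +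
      d * (prodBernoulli w).real ({ω : BondConfig (Fin n) | ∀ y ∈ X, ¬ (openGraph ω).Reachable c y} ∩ Q) := by
  set N : Set (BondConfig (Fin n)) := {ω | ∀ y ∈ X, ¬ (openGraph ω).Reachable c y} with hN
  have hB : ∀ ω ω', ω ∈ (openConn c b : Set (BondConfig (Fin n))) →
      openEdgeCluster ω c ⊆ openEdgeCluster ω' c → ω' ∈ (openConn c b : Set (BondConfig (Fin n))) := by
    intro ω ω' hω hsub
    rw [openConn, Set.mem_setOf_eq, reachable_iff_exists_mem_openEdgeCluster] at hω ⊢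
    exact hω.imp id fun ⟨e, he, hbe⟩ => ⟨e, hsub he, hbe⟩
  have hA : ∀ ω ω', ω ∈ (openConn v b : Set (BondConfig (Fin n))) →
      openEdgeCluster ω v ⊆ openEdgeCluster ω' v → ω' ∈ (openConn v b : Set (BondConfig (Fin n))) := by
    intro ω ω' hω hsub
    rw [openConn, Set.mem_setOf_eq, reachable_iff_exists_mem_openEdgeCluster] at hω ⊢
    exact hω.imp id fun ⟨e, he, hbe⟩ => ⟨e, hsub he, hbe⟩
  have hI := rbhk_neg w c v X hvX hcX (openConn c b) Q hB hQ
  have hII := rbhk_pos w c v X hvX hcX (openConn v b) Q hA hQ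
  change (prodBernoulli w).real N * (prodBernoulli w).real (N ∩ (openConn c b ∩ Q)) ≤
    (prodBernoulli w).real (N ∩ openConn c b) * (prodBernoulli w).real (N ∩ Q) at hI
  change (prodBernoulli w).real (N ∩ openConn v b) * (prodBernoulli w).real (N ∩ Q) ≤
    (prodBernoulli w).real N * (prodBernoulli w).real (N ∩ (openConn v b ∩ Q)) at hII
  rw [Set.inter_assoc, Set.inter_assoc]
  have hq : 0 ≤ (prodBernoulli w).real (N ∩ Q) := measureReal_nonneg
  nlinarith [hI, hII, mul_le_mul_of_nonneg_right hle hq]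

/-- **Restricted star-gluing Lemma 5.**  `D` a star of pairs at `x`, `v` an endpoint (`s(x,v) ∈ D`, `v ≠ x`),
`M = {c ↮ X}` with `c ∉ X`, `c ≠ v`.  If `μ_w(M ∩ {c↔b}) ≤ μ_w(M ∩ {v↔b})` then, for the weighting with `D` glued,
`μ_glue(M ∩ {c↔b}) ≤ μ_glue(M ∩ {v↔b})`.  (Sprinkle `ε` on `D`; the event "all of `D` open" is increasing in `C_v`;
restricted Lemma 3(i) on `{c ↮ X ∪ {v}}`; condition; `ε → 0`.)  For `X = ∅` this is `starGlue_lemma5`.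
[cite: KozmaNitzan2024, Lemma 5 (p. 13), Lemma 3(i) (pp. 6–7)] -/
theorem starGlue_lemma5_restricted (w : Sym2 (Fin n) → unitInterval) (x : Fin n) (D : Finset (Sym2 (Fin n)))
    (hD : ∀ e ∈ D, ∃ a, a ≠ x ∧ e = s(x, a)) (c v b : Fin n) (X : Set (Fin n)) (hcX : c ∉ X) (hcv : c ≠ v)
    (hv : s(x, v) ∈ D) (hvx : v ≠ x)
    (hle : (prodBernoulli w).real ({ω : BondConfig (Fin n) | ∀ y ∈ X, ¬ (openGraph ω).Reachable c y} ∩ openConn c b) ≤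
      (prodBernoulli w).real ({ω : BondConfig (Fin n) | ∀ y ∈ X, ¬ (openGraph ω).Reachable c y} ∩ openConn v b)) :
    (prodBernoulli (fun e : Sym2 (Fin n) => if e ∈ D then 1 else w e)).real
        ({ω : BondConfig (Fin n) | ∀ y ∈ X, ¬ (openGraph ω).Reachable c y} ∩ openConn c b) ≤
      (prodBernoulli (fun e : Sym2 (Fin n) => if e ∈ D then 1 else w e)).real
        ({ω : BondConfig (Fin n) | ∀ y ∈ X, ¬ (openGraph ω).Reachable c y} ∩ openConn v b) := by
  set g : Sym2 (Fin n) → unitInterval := fun e => if e ∈ D then 1 else w e with hg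
  set M : Set (BondConfig (Fin n)) := {ω | ∀ y ∈ X, ¬ (openGraph ω).Reachable c y} with hM
  set N : Set (BondConfig (Fin n)) := {ω | ∀ y ∈ insert v X, ¬ (openGraph ω).Reachable c y} with hN
  set E : Set (BondConfig (Fin n)) := {ω | (↑D : Set (Sym2 (Fin n))) ⊆ ω} with hEdef
  -- `N = M ∖ {c ↔ v}`; on `{c ↔ v}` the events `{c ↔ b}`, `{v ↔ b}` coincide
  have hNeq : N = M \ (openConn c v : Set (BondConfig (Fin n))) := by
    ext ω
    simp only [hN, hM, Set.mem_setOf_eq, Set.mem_insert_iff, forall_eq_or_imp, Set.mem_sdiff, openConn]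
    tauto
  have hDm : MeasurableSet (openConn c v : Set (BondConfig (Fin n))) := MeasurableSet.of_discrete
  have hsplit : ∀ (p : Sym2 (Fin n) → unitInterval) (u : Fin n),
      (prodBernoulli p).real (M ∩ openConn u b) =
        (prodBernoulli p).real (M ∩ openConn u b ∩ openConn c v) + (prodBernoulli p).real (N ∩ openConn u b) := by
    intro p u
    have h := measureReal_inter_add_sdiff (μ := prodBernoulli p) (s := M ∩ openConn u b) hDm
    have hset : (M ∩ openConn u b) \ (openConn c v : Set (BondConfig (Fin n))) = N ∩ openConn u b := by
      rw [hNeq]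
      ext ω
      simp only [Set.mem_sdiff, Set.mem_inter_iff]
      tauto
    rw [← h, hset]
  have hagree : M ∩ openConn c b ∩ openConn c v = M ∩ openConn v b ∩ openConn c v := by
    ext ω
    simp only [Set.mem_inter_iff, openConn, Set.mem_setOf_eq]
    constructor
    · rintro ⟨⟨hM1, h1⟩, h2⟩; exact ⟨⟨hM1, h2.symm.trans h1⟩, h2⟩
    · rintro ⟨⟨hM1, h1⟩, h2⟩; exact ⟨⟨hM1, h2.trans h1⟩, h2⟩
  -- reduce to the `N`-statement
  suffices hNst : (prodBernoulli g).real (N ∩ openConn c b) ≤ (prodBernoulli g).real (N ∩ openConn v b) by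
    rw [hsplit g c, hsplit g v, hagree]
    exact add_le_add le_rfl hNst
  have hleN : (prodBernoulli w).real (N ∩ openConn c b) ≤ (prodBernoulli w).real (N ∩ openConn v b) := by
    have h1 := hsplit w c
    have h2 := hsplit w v
    rw [hagree] at h1
    linarith
  have hvX' : v ∈ insert v X := Set.mem_insert _ _
  have hcX' : c ∉ insert v X := by
    simp only [Set.mem_insert_iff, not_or]; exact ⟨hcv, hcX⟩
  -- the sprinkled weights `u ε`
  set u : unitInterval → Sym2 (Fin n) → unitInterval :=
    fun ε e => if e ∈ D then Set.Icc.convexComb (w e) 1 ε else w e with hu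
  have hwu : ∀ ε, w ≤ u ε := by
    intro ε e
    by_cases he : e ∈ D
    · simp only [hu, he, if_true]
      exact Set.Icc.le_convexComb unitInterval.le_one' ε
    · simp only [hu, he, if_false]
      exact le_rfl
  have hug : ∀ ε, u ε ≤ g := by
    intro ε e
    by_cases he : e ∈ D
    · simp only [hu, hg, he, if_true]
      exact unitInterval.le_one _
    · simp only [hu, hg, he, if_false]
      exact le_rfl
  have hu0 : u 0 = w := by
    funext e
    by_cases he : e ∈ D
    · simp only [hu, he, if_true, Set.Icc.convexComb_zero]
    · simp only [hu, he, if_false]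
  have hucont : Continuous u := by
    refine continuous_pi fun e => ?_
    by_cases he : e ∈ D
    · simp only [hu, he, if_true]
      exact Set.Icc.continuous_convexComb (w e) 1
    · simp only [hu, he, if_false]
      exact continuous_const
  have hpin : ∀ ε, (fun e => if e ∈ D then (1 : unitInterval) else u ε e) = g := by
    intro ε
    funext e
    by_cases he : e ∈ D
    · simp only [hg, he, if_true]
    · simp only [hg, hu, he, if_false]
  have hcond : ∀ ε (Y : Set (BondConfig (Fin n))),
      (prodBernoulli (u ε)).real (Y ∩ E) = (prodBernoulli (u ε)).real E * (prodBernoulli g).real Y := by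
    intro ε Y
    rw [hEdef, gluingLemma5_real_inter_allOpen (u ε) D MeasurableSet.of_discrete, hpin ε]
  have hpos : ∀ ε : unitInterval, 0 < (ε : ℝ) → 0 < (prodBernoulli (u ε)).real E := by
    intro ε hε
    rw [hEdef, prodBernoulli_real_subset (u ε) D]
    refine Finset.prod_pos fun e he => ?_
    simp only [hu, he, if_true, Set.Icc.coe_convexComb, Set.Icc.coe_one, mul_one]
    exact add_pos_of_nonneg_of_pos
      (mul_nonneg (unitInterval.one_minus_nonneg ε) (unitInterval.nonneg (w e))) hε
  -- the continuous functions of `ε`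
  set Fc : unitInterval → ℝ := fun t => (prodBernoulli (u t)).real (N ∩ openConn c b) with hFc
  set Fv : unitInterval → ℝ := fun t => (prodBernoulli (u t)).real (N ∩ openConn v b) with hFv
  set FN : unitInterval → ℝ := fun t => (prodBernoulli (u t)).real N with hFN
  have hFc_cont : Continuous Fc := (stub_weightContinuity n (N ∩ openConn c b)).comp hucont
  have hFv_cont : Continuous Fv := (stub_weightContinuity n (N ∩ openConn v b)).comp hucont
  have hFN_cont : Continuous FN := (stub_weightContinuity n N).comp hucont
  set dd : unitInterval → ℝ := fun t => |Fc t - Fc 0| + |Fv t - Fv 0| with hdd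
  -- the step at fixed `ε > 0`
  have hstep : ∀ ε : unitInterval, 0 < (ε : ℝ) →
      FN ε * (prodBernoulli g).real (N ∩ openConn c b) ≤
        FN ε * (prodBernoulli g).real (N ∩ openConn v b) + dd ε := by
    intro ε hε
    have hdε : 0 ≤ dd ε := add_nonneg (abs_nonneg _) (abs_nonneg _)
    have hypε : (prodBernoulli (u ε)).real (N ∩ openConn c b) ≤
        (prodBernoulli (u ε)).real (N ∩ openConn v b) + dd ε := by
      have h1 : Fc 0 ≤ Fv 0 := by simp only [hFc, hFv, hu0]; exact hleN
      have h2 := le_abs_self (Fc ε - Fc 0)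
      have h3 := neg_abs_le (Fv ε - Fv 0)
      change Fc ε ≤ Fv ε + (|Fc ε - Fc 0| + |Fv ε - Fv 0|)
      linarith
    have h3 := knLemma3i_restricted_prod (u ε) c v b (insert v X) hvX' hcX' E (dd ε)
      (starGlue_allOpen_mono hD hv hvx) hypε
    rw [hcond ε (N ∩ openConn c b), hcond ε (N ∩ openConn v b), hcond ε N] at h3
    have hEpos := hpos ε hε
    have hNle : (prodBernoulli g).real N ≤ 1 := measureReal_le_one
    -- divide by `μ(E) > 0`
    have h4 : FN ε * (prodBernoulli g).real (N ∩ openConn c b) ≤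
        FN ε * (prodBernoulli g).real (N ∩ openConn v b) + dd ε * (prodBernoulli g).real N := by
      have := h3
      change FN ε * ((prodBernoulli (u ε)).real E * (prodBernoulli g).real (N ∩ openConn c b)) ≤
        FN ε * ((prodBernoulli (u ε)).real E * (prodBernoulli g).real (N ∩ openConn v b)) +
          dd ε * ((prodBernoulli (u ε)).real E * (prodBernoulli g).real N) at this
      have key : (prodBernoulli (u ε)).real E * (FN ε * (prodBernoulli g).real (N ∩ openConn c b)) ≤
          (prodBernoulli (u ε)).real E * (FN ε * (prodBernoulli g).real (N ∩ openConn v b) +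
            dd ε * (prodBernoulli g).real N) := by
        nlinarith [this]
      exact le_of_mul_le_mul_left key hEpos
    nlinarith [h4, mul_le_mul_of_nonneg_left hNle hdε]
  -- `ε → 0`
  obtain ⟨ε, hεpos, hεlim⟩ := gluingLemma5_exists_seq_tendsto_zero
  have hdd_cont : Continuous dd := by
    simp only [hdd]
    exact ((hFc_cont.sub continuous_const).abs).add ((hFv_cont.sub continuous_const).abs)
  have hdd0 : dd 0 = 0 := by simp only [hdd, sub_self, abs_zero, add_zero]
  have hlimL : Tendsto (fun k => FN (ε k) * (prodBernoulli g).real (N ∩ openConn c b)) atTop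
      (𝓝 (FN 0 * (prodBernoulli g).real (N ∩ openConn c b))) :=
    ((hFN_cont.tendsto 0).comp hεlim).mul tendsto_const_nhds
  have hlimR : Tendsto (fun k => FN (ε k) * (prodBernoulli g).real (N ∩ openConn v b) + dd (ε k)) atTop
      (𝓝 (FN 0 * (prodBernoulli g).real (N ∩ openConn v b) + dd 0)) :=
    (((hFN_cont.tendsto 0).comp hεlim).mul tendsto_const_nhds).add ((hdd_cont.tendsto 0).comp hεlim)
  have hlim := le_of_tendsto_of_tendsto' hlimL hlimR fun k => hstep (ε k) (hεpos k)
  rw [hdd0, add_zero] at hlim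
  have hFN0 : FN 0 = (prodBernoulli w).real N := by simp only [hFN, hu0]
  rw [hFN0] at hlim
  -- conclude: either `μ_w(N) > 0`, or `μ_g(N) = 0`
  rcases (measureReal_nonneg : 0 ≤ (prodBernoulli w).real N).eq_or_lt with h0 | hpos0
  · -- `N` is decreasing, so `μ_g(N) ≤ μ_w(N) = 0`
    have hup : IsUpperSet (Nᶜ : Set (BondConfig (Fin n))) := by
      intro ω ω' hle' hω hω'
      apply hω
      intro y hy hr
      exact hω' y hy (SimpleGraph.Reachable.mono (openGraph_mono hle') hr)
    have hmono := prodBernoulli_real_mono_of_isUpperSet ((hwu 1).trans (hug 1)) hup MeasurableSet.of_discrete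
    have hcw : (prodBernoulli w).real Nᶜ = 1 - (prodBernoulli w).real N := by
      rw [measureReal_compl MeasurableSet.of_discrete, probReal_univ]
    have hcg : (prodBernoulli g).real Nᶜ = 1 - (prodBernoulli g).real N := by
      rw [measureReal_compl MeasurableSet.of_discrete, probReal_univ]
    have hgN : (prodBernoulli g).real N = 0 := by
      have : (prodBernoulli g).real N ≤ (prodBernoulli w).real N := by rw [hcw, hcg] at hmono; linarith
      exact le_antisymm (this.trans_eq h0.symm) measureReal_nonneg
    have h1 : (prodBernoulli g).real (N ∩ openConn c b) = 0 :=
      le_antisymm ((measureReal_mono Set.inter_subset_left (measure_ne_top _ _)).trans_eq hgN) measureReal_nonneg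
    rw [h1]
    exact measureReal_nonneg
  · exact le_of_mul_le_mul_left hlim hpos0

end AL5RestrictedLemma5

end

end Summit.CriticalPhenomena.PercolationContinuityZ3.Theorems
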